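import Summits.Ventures.LatticeQCDFlow.TrivializingMaps.SpecificHeatCeilingTwoDim
import Summits.Ventures.LatticeQCDFlow.TrivializingMaps.ReweightingWindowsStrongCoupling
import Summits.Ventures.LatticeQCDFlow.Scaling.CouplingOverlap
import Summits.Ventures.LatticeQCDFlow.Scaling.LeCamSwapFloor

/-!
HONEST FRAMING: exact (Metropolis-corrected) sampling algorithms for lattice gauge theory; figures
of merit are autocorrelation/cost numbers at stated couplings and volumes; no continuum-physics
claim.

# CouplingLadderLawTwoDim — IN TWO DIMENSIONS EVERY COUPLING-TRANSFER LAW OF THE TREE IS TWO-SIDED AT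
# EVERY COUPLING: Gaussian floors `swapAcc ≥ ½e^{−M(b−a)²/2}`, `overlap ≥ e^{−((b−a)√M + M(b−a)²)}` with
# `M = 2N²e^{2NB}L²`, `⌈(b−a)·√2·N·e^{NB}·L·max(1, 3/log(1/α))⌉` tempering replicas SUFFICE and
# `Ω((b−a)·L)` are NECESSARY, and uniform reweighting windows of width `δ = √(t₀/M)` are admissible —
# EVERY COMPACT GAUGE GROUP, EVERY COUPLING WINDOW `[−B, B]`, EVERY `L ≥ 2` (lean-2 GEN-12, ours)

Venture-side (OURS).  Cell `lqcd-flow` (pub-lqcd), unit `pub-lqcd-lean-2-g12`, 2026-08-23.  The docking of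
the two-dimensional specific-heat ceiling `Var_{μ_u}(S_W^ρ) ≤ 2N²e^{2N|u|}L²`
(`SpecificHeatCeilingTwoDim.wilson_variance_le_twoDim`) into the tree's laws "under a ceiling `M`":
GEN-11's `wilson_swapAcc_ge_of_ceiling`, `wilson_ladder_sufficient` (`CouplingLadderLawAnyGroup`),
`wilson_overlap_ge_of_ceiling` (`Scaling/CouplingOverlap`), `wilson_swapAcc_ge_half_of_ceiling`
(`Scaling/LeCamSwapFloor`), and GEN-10's `uniform_window_sufficient` (`ReweightingWindowsStrongCoupling`).
Outside the strong-coupling window these laws were one-sided in every dimension (`√volume ≲ K ≲ volume`,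
GEN-11's NOT CLAIMED); in `d = 2` they are now two-sided `Θ(√volume) = Θ(L)` at EVERY coupling.

## What is proved (`d = 2`, `L ≥ 2`, compact second-countable `G`, continuous `ρ : G →* M_N(ℂ)`;
`M_B := 2N²·exp(2NB)·L²`, `√M_B = √2·N·e^{NB}·L`)

* `wilson_variance_le_twoDim_of_abs_le` — `|u| ≤ B ⇒ Var_{μ_u}(S_W) ≤ M_B`; `sqrt_twoDimCeiling`.
* **`wilson_swapAcc_ge_twoDim`** — `−B ≤ a ≤ b ≤ B ⇒ swapAcc(a,b) ≥ exp(−((b−a)√(2M_B) + M_B(b−a)²))`;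
  **`wilson_swapAcc_ge_half_twoDim`** — `swapAcc(a,b) ≥ ½·exp(−M_B(b−a)²/2)` (Le Cam);
  **`wilson_overlap_ge_twoDim`** — `∫ min(p_a,p_b) dD[U] ≥ exp(−((b−a)√M_B + M_B(b−a)²))`.
* **`wilson_ladder_sufficient_twoDim`** — the uniform ladder `a + jδ`, `j ≤ K`, inside `[−B, B]` with
  `δ·√2·N·e^{NB}·L ≤ 1` and `3·δ·√2·N·e^{NB}·L ≤ log(1/α)` has every adjacent swap rate `≥ α`:
  `⌈(b−a)·√2·N·e^{NB}·L·max(1, 3/log(1/α))⌉` replicas SUFFICE; with **`wilson_ladder_necessary_twoDim`**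
  (GEN-9's floor at `d = 2`: `e^{−B·2N·12·49}·⌊L/2⌋²·Var_Haar(Re tr ρ)·(β_K − β_0)² ≤ 4K²·log(1/α)`, unitary
  `ρ`): **`Θ((b−a)·L)` REPLICAS, TWO-SIDED, AT EVERY COUPLING IN TWO DIMENSIONS.**
* **`wilson_windows_sufficient_twoDim`** — exact reweighting along the uniform schedule `a + jδ` inside
  `[−B, B]` with `δ²·M_B ≤ t₀` has every per-step cost `Δ²ψ ≤ t₀`: `O((b−a)·L/√t₀)` windows SUFFICE at
  every coupling (necessity `Ω((b−a)·L/√t₀)`: GEN-10's `window_steps_necessary` with GEN-9's floor).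

Reading (no numerics implied): for two-dimensional lattice gauge theory with any compact gauge group —
the setting of the cell's STEP-0 `U(1)` rung — parallel tempering in the coupling, simulated tempering and
sequential reweighting between couplings `a < b` all need and make do with `Θ((b−a)·L)` intermediate
couplings per unit target acceptance, at every coupling, uniformly in nothing but the stated constants.
NOT CLAIMED: `d ≥ 3`; sharp constants (`e^{NB}` vs the floor's `e^{−cB}` leave the `β`-dependence of the
true replica count open; for `U(1)` row 5's exact variance gives it); round-trip / autocorrelation times;
the continuum.  Literature grade (cell rule): KNOWN MECHANISM (`√C_V` replica spacing; 2-d reduction to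
independent plaquettes), NEW TYPING; nothing is cited as a fact.
-/

noncomputable section

open MeasureTheory ProbabilityTheory Real Set
open Literature.MathematicalPhysics.QuantumFieldTheory
open Literature.MathematicalPhysics.QuantumFieldTheory.Luscher2010
open Summit.Ventures.LatticeQCDFlow.Scaling

namespace Summit.Ventures.LatticeQCDFlow.TrivializingMaps

section TwoDim

variable {L N : ℕ} [NeZero L] {G : Type*} [Group G] [TopologicalSpace G] [IsTopologicalGroup G]
  [CompactSpace G] [MeasurableSpace G] [BorelSpace G] [SecondCountableTopology G]
  (ρ : G →* Matrix (Fin N) (Fin N) ℂ)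

/-- **The ceiling on a coupling window**: `|u| ≤ B ⇒ Var_{μ_u}(S_W^ρ) ≤ 2N²·exp(2NB)·L²` (`d = 2`,
`L ≥ 2`). [ours] -/
theorem wilson_variance_le_twoDim_of_abs_le (hL : 2 ≤ L) (hρ : Continuous ρ) {B u : ℝ} (hu : |u| ≤ B) :
    variance (wilsonAction (d := 2) (L := L) ρ) (wilsonMeasure (d := 2) (L := L) ρ u) ≤
      2 * (N : ℝ) ^ 2 * exp (2 * N * B) * (L : ℝ) ^ 2 := by
  refine (wilson_variance_le_twoDim ρ hL hρ u).trans ?_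
  gcongr

omit [NeZero L] in
/-- `√(2N²·e^{2NB}·L²) = √2·N·e^{NB}·L`. [folklore] -/
theorem sqrt_twoDimCeiling (B : ℝ) :
    sqrt (2 * (N : ℝ) ^ 2 * exp (2 * N * B) * (L : ℝ) ^ 2) = sqrt 2 * N * exp (N * B) * L := by
  have h2 : (0 : ℝ) ≤ sqrt 2 := sqrt_nonneg 2
  have hsq : 2 * (N : ℝ) ^ 2 * exp (2 * N * B) * (L : ℝ) ^ 2 = (sqrt 2 * N * exp (N * B) * L) ^ 2 := by
    rw [show 2 * (N : ℝ) * B = N * B + N * B by ring, exp_add]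
    nlinarith [sq_sqrt (show (0 : ℝ) ≤ 2 by norm_num)]
  rw [hsq, sqrt_sq (by positivity)]

/-- **SWAP-ACCEPTANCE FLOOR AT EVERY COUPLING, `d = 2`**: for `−B ≤ a ≤ b ≤ B`,
`swapAcc(a,b) ≥ exp(−((b−a)·√(2M_B) + M_B·(b−a)²))`, `M_B = 2N²e^{2NB}L²`. [ours] -/
theorem wilson_swapAcc_ge_twoDim (hL : 2 ≤ L) (hρ : Continuous ρ) {a b B : ℝ} (hab : a ≤ b)
    (ha : -B ≤ a) (hb : b ≤ B) :
    exp (-((b - a) * sqrt (2 * (2 * (N : ℝ) ^ 2 * exp (2 * N * B) * (L : ℝ) ^ 2)) +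
        2 * (N : ℝ) ^ 2 * exp (2 * N * B) * (L : ℝ) ^ 2 * (b - a) ^ 2)) ≤
      swapAcc (fun U => -wilsonAction ρ U) (trivialMeasure G 2 L) a b :=
  wilson_swapAcc_ge_of_ceiling (d := 2) (L := L) ρ hρ hab fun u hu =>
    wilson_variance_le_twoDim_of_abs_le ρ hL hρ (abs_le.2 ⟨by linarith [hu.1], by linarith [hu.2]⟩)

/-- **GAUSSIAN SWAP FLOOR AT EVERY COUPLING, `d = 2`** (Le Cam): for `−B ≤ a ≤ b ≤ B`,
`swapAcc(a,b) ≥ ½·exp(−M_B(b−a)²/2)`. With GEN-9's floor (`swapAcc ≤ exp(−m(b−a)²/4)`,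
`m = e^{−cB}⌊L/2⌋²v_ρ`): the swap acceptance between two-dimensional Wilson measures is a Gaussian in
`(b−a)·L` from both sides. [ours] -/
theorem wilson_swapAcc_ge_half_twoDim (hL : 2 ≤ L) (hρ : Continuous ρ) {a b B : ℝ} (hab : a ≤ b)
    (ha : -B ≤ a) (hb : b ≤ B) :
    exp (-(2 * (N : ℝ) ^ 2 * exp (2 * N * B) * (L : ℝ) ^ 2 * (b - a) ^ 2 / 2)) / 2 ≤
      swapAcc (fun U => -wilsonAction ρ U) (trivialMeasure G 2 L) a b :=
  wilson_swapAcc_ge_half_of_ceiling (d := 2) (L := L) ρ hρ hab fun u hu =>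
    wilson_variance_le_twoDim_of_abs_le ρ hL hρ (abs_le.2 ⟨by linarith [hu.1], by linarith [hu.2]⟩)

/-- **OVERLAP FLOOR AT EVERY COUPLING, `d = 2`**: for `−B ≤ a ≤ b ≤ B`,
`∫ min(p_a, p_b) dD[U] ≥ exp(−((b−a)·√M_B + M_B·(b−a)²))` — two Wilson measures a coupling distance
`O(1/L)` apart have overlap bounded below (and, by GEN-11's `wilson_overlap_le_allCouplings`, above) by
Gaussians in `(b−a)·L`. [ours] -/
theorem wilson_overlap_ge_twoDim (hL : 2 ≤ L) (hρ : Continuous ρ) {a b B : ℝ} (hab : a ≤ b)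
    (ha : -B ≤ a) (hb : b ≤ B) :
    exp (-((b - a) * sqrt (2 * (N : ℝ) ^ 2 * exp (2 * N * B) * (L : ℝ) ^ 2) +
        2 * (N : ℝ) ^ 2 * exp (2 * N * B) * (L : ℝ) ^ 2 * (b - a) ^ 2)) ≤
      ∫ U, min (exp (a * (-wilsonAction ρ U)) / mgf (fun U => -wilsonAction ρ U) (trivialMeasure G 2 L) a)
        (exp (b * (-wilsonAction ρ U)) / mgf (fun U => -wilsonAction ρ U) (trivialMeasure G 2 L) b)
        ∂(trivialMeasure G 2 L) :=
  wilson_overlap_ge_of_ceiling (d := 2) (L := L) ρ hρ hab fun u hu =>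
    wilson_variance_le_twoDim_of_abs_le ρ hL hρ (abs_le.2 ⟨by linarith [hu.1], by linarith [hu.2]⟩)

/-- **LADDER SUFFICIENCY AT EVERY COUPLING, `d = 2`**: the uniform coupling ladder `a + jδ`, `j ≤ K`,
inside `[−B, B]` (`δ ≥ 0`) with `δ·√2·N·e^{NB}·L ≤ 1` and `3·δ·√2·N·e^{NB}·L ≤ log(1/α)` has every
adjacent swap rate `≥ α`: **`⌈(b−a)·√2·N·e^{NB}·L·max(1, 3/log(1/α))⌉` replicas suffice** — `O(L)`, i.e.
`O(√#plaq)`, at every coupling for every compact gauge group in two dimensions. [ours] -/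
theorem wilson_ladder_sufficient_twoDim (hL : 2 ≤ L) (hρ : Continuous ρ) {a δ α B : ℝ} (hδ : 0 ≤ δ)
    {K : ℕ} (ha : -B ≤ a) (hb : a + K * δ ≤ B)
    (hu1 : δ * (sqrt 2 * N * exp (N * B) * L) ≤ 1)
    (hu2 : 3 * (δ * (sqrt 2 * N * exp (N * B) * L)) ≤ log (1 / α)) (hα : 0 < α) :
    ∀ j < K, α ≤ swapAcc (fun U => -wilsonAction ρ U) (trivialMeasure G 2 L) (a + j * δ)
      (a + (j + 1) * δ) := by
  refine wilson_ladder_sufficient (d := 2) (L := L) ρ hρ hδ (M := 2 * (N : ℝ) ^ 2 * exp (2 * N * B) * (L : ℝ) ^ 2)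
    (by positivity) (fun u hu => wilson_variance_le_twoDim_of_abs_le ρ hL hρ
      (abs_le.2 ⟨by linarith [hu.1], by linarith [hu.2]⟩)) ?_ ?_ hα
  · rwa [sqrt_twoDimCeiling]
  · rwa [sqrt_twoDimCeiling]

/-- **LADDER NECESSITY AT EVERY COUPLING, `d = 2`** (GEN-9's floor, unitary `ρ`, `L ≥ 2`): a monotone
coupling ladder inside `[−B, B]` with all adjacent swap rates `≥ α > 0` satisfies
`e^{−B·2N·12·(1+4·12)}·⌊L/2⌋²·Var_Haar(Re tr ρ)·(β_K − β_0)² ≤ 4K²·log(1/α)` — **`Ω((β_K − β_0)·L)`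
replicas are necessary**; with `wilson_ladder_sufficient_twoDim`: `Θ((b−a)·L)` two-sided. [ours] -/
theorem wilson_ladder_necessary_twoDim (hL : 2 ≤ L) (hρ : Continuous ρ)
    (hρu : ∀ g, ρ g ∈ Matrix.unitaryGroup (Fin N) ℂ) (K : ℕ) (β : ℕ → ℝ) (hβ : Monotone β) {B : ℝ}
    (hlo : -B ≤ β 0) (hhi : β K ≤ B) {α : ℝ} (hα : 0 < α)
    (hacc : ∀ j < K, α ≤ swapAcc (fun U => -wilsonAction ρ U) (trivialMeasure G 2 L) (β j) (β (j + 1))) :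
    Real.exp (-(B * (2 * N * ((2 + 1) * 2 ^ 2 : ℕ) * (1 + 4 * ((2 + 1) * 2 ^ 2 : ℕ))))) *
        ((L / 2) ^ 2 : ℕ) * variance (fun g => (ρ g).trace.re) (haarProbability G) * (β K - β 0) ^ 2 ≤
      4 * (K : ℝ) ^ 2 * log (1 / α) :=
  wilson_ladder_necessary_allCouplings (d := 2) (L := L) ρ le_rfl hL hρ hρu K β hβ hlo hhi hα hacc

/-- **REWEIGHTING WINDOWS AT EVERY COUPLING, `d = 2`**: the uniform schedule `a + jδ`, `j ≤ k`, inside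
`[−B, B]` (`δ ≥ 0`) with `δ²·M_B ≤ t₀` is admissible at every step (`Δ²ψ(a + jδ; δ) ≤ t₀`, i.e. per-step
weight second moment `≤ e^{t₀}`): **`O((b−a)·L/√t₀)` exact reweighting windows suffice at every coupling**
(necessity of the same order: GEN-10's `window_steps_necessary` with GEN-9's floor). [ours] -/
theorem wilson_windows_sufficient_twoDim (hL : 2 ≤ L) (hρ : Continuous ρ) {a δ t₀ B : ℝ} (hδ : 0 ≤ δ)
    {k : ℕ} (ha : -B ≤ a) (hb : a + (k + 1) * δ ≤ B)
    (hδM : δ ^ 2 * (2 * (N : ℝ) ^ 2 * exp (2 * N * B) * (L : ℝ) ^ 2) ≤ t₀) :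
    ∀ j < k,
      cgf (fun U => -wilsonAction ρ U) (trivialMeasure G 2 L) (a + j * δ + 2 * δ) -
        2 * cgf (fun U => -wilsonAction ρ U) (trivialMeasure G 2 L) (a + j * δ + δ) +
        cgf (fun U => -wilsonAction ρ U) (trivialMeasure G 2 L) (a + j * δ) ≤ t₀ :=
  uniform_window_sufficient (d := 2) (L := L) ρ hρ hδ (fun u hu =>
    wilson_variance_le_twoDim_of_abs_le ρ hL hρ (abs_le.2 ⟨by linarith [hu.1], by linarith [hu.2]⟩)) hδM

end TwoDim

end Summit.Ventures.LatticeQCDFlow.TrivializingMaps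

end
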